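import Literature.NumberTheory.LFunctions.MertensErrorTermsMeanValueRHWindow
import Literature.NumberTheory.LFunctions.MertensFirstChainSound
import Literature.NumberTheory.LFunctions.MertensFirstChainRun1
import Literature.NumberTheory.LFunctions.MertensFirstChainRun2
import Literature.NumberTheory.LFunctions.RosserSchoenfeldMertensChainSound
import Literature.NumberTheory.Multiplicative.ChebyshevThetaExplicit
import Literature.Analysis.SpecialFunctions.KernelLog
import Literature.Analysis.SpecialFunctions.LogPiBounds
import Literature.Analysis.SpecialFunctions.EulerMascheroniBounds
import HarnessLib

/-!
# RH-EQUIVALENT literature, proof layer — «nothing here bears on the truth of RH»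
# Zhao 2025, Theorem 1, clause `i = 1`, AS PRINTED: `RH ⟺ ∫₂^X E₁(x) dx > 0` for ALL `X > 2` (proved)

Proof companion of `MertensErrorTermsMeanValueRH.lean` (T. Zhao, *On the mean values of the error terms in
Mertens' theorems*, Res. Number Theory **11** (2025) 62 = arXiv:2411.18903 [bib: `Zhao2025MertensMean`], refereed);
theorems only — no definition, no named fact, no endorsement beyond the kernel facts below. TRIAGE-TYPING tranche 1
part 2 (RH literature, D-0088(4) cross-ladder layer).

The named fact `Zhao2025MertensMean_thm1` types Theorem 1 AS PRINTED: for `i ∈ {1, 2}`,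
`RH ⟺ ∫₂^X E_i(x) dx > 0` for all `X > 2`. For `i = 1` the tree already held: the direction `⟸` as printed
(`Zhao2025.riemannHypothesis_of_integral_E₁_pos`, Landau's theorem, `MertensErrorTermsMeanValueRHLandau.lean`) and
the direction `⟹` for all SUFFICIENTLY LARGE `X` (`Zhao2025.eventually_integral_E₁_pos_of_RH`,
`MertensErrorTermsMeanValueRHSufficiency.lean`, with an inexplicit threshold coming from `ψ − θ ≥ √x/2` via the
prime number theorem). The printed «for all `X > 2`» rests, in the source (§2, first sentence), on the numerical
input «`E₁(x) > 0` for `2 ≤ x ≤ 10⁸`» [RS]. This file closes the gap IN THE KERNEL, with a much smaller crossover: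

* §1 `Zhao2025.rosserSchoenfeldE_gt` — **`E = ℰ₁ > −1.333`** from the tree's kernel-certified Rosser–Schoenfeld
  chain over the complete prime table up to `442439` (`MertensFirstChainRun1/Run2.lean`, `MertensFirstChainSound.lean`:
  `−ELO/2⁸⁰ ≤ E`, `ELO/2⁸⁰ = 1.3329…`; the assembly announced there as `MertensFirstSmallRange.lean` is supplied
  here in three lines), and `Zhao2025.rosserSchoenfeldE_lt` — **`E < −1.2336`** (partial sum over `p ≤ 7` of
  `−E = γ + Σ_p (log p)/(p(p−1))`, `MertensChain.neg_rosserSchoenfeldE_ge`, with the tree's `γ > 0.57721558`);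
* §2 kernel enclosures of `log 3, log 5, log 7, log 11` (`KernelLog.logIv`, evaluated by `decide +kernel`);
* §3 the source's §2 argument with EXPLICIT constants: `ψ(t) − θ(t) ≥ θ(√t) ≥ √t/4` for `t ≥ 9` (the tree's
  effective `quarter_le_theta`, in place of the printed `0.98√x`, `x ≥ 121` [RS]), Rosser–Schoenfeld's Lemma 7 in
  exact form (`PsiTailIntegral.integral_Ioi_psi_sub_self_div_sq_le`, keeping its `−log(2π)/x`), `K(x) = β/√x` under RH
  (`β = nicolasBeta = B₁ < 0.0474`), whence for `X ≥ 9`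
  `∫₂^X E₁ ≥ 2 log 2 − 2 + 2E + log 2π − 1/(2(X² − 1)) + (1/2 − β)√X` (`integral_E₁_ge_explicit_of_RH`) and
  **`∫₂^X E₁ > 0` for every `X ≥ 11` under RH** (`integral_E₁_pos_of_RH_of_eleven_le`);
* §4 the finite range WITHOUT RH: **`E₁(x) > 0` for `2 ≤ x < 11`** (`E₁_pos_of_lt_eleven`: four prime gaps,
  `S(x) − log x ≥ S(p) − log p′ ≥ −1.0853 > −1.2336 > E`), hence `∫₂^X E₁ > 0` for `2 < X ≤ 11`;
* §5 **Theorem 1, clause `i = 1`, AS PRINTED, PROVED**: `Zhao2025.integral_E₁_pos_of_RH` (`RH ⟹ ∀ X > 2,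
  ∫₂^X E₁ > 0`) and `Zhao2025MertensMean_thm1_clause1 : RiemannHypothesis ↔ ∀ X > 2, 0 < ∫₂^X E₁`, i.e. the first
  conjunct of the named fact `Zhao2025MertensMean_thm1` is a theorem of the tree (`Zhao2025MertensMean_thm1_clause1_eq`).
  Clause `i = 2` keeps its eventual form (`MertensErrorTermsMeanValueRHSufficiencyPiLi.lean`); the fact is not
  discharged as a whole.

RH-EQUIVALENT criterion; an equivalence says nothing about the truth of RH. 0 sorry, standard axioms (the chain runs
are `decide +kernel` certificates already in the tree).
-/

noncomputable section

open Filter Topology Set MeasureTheory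
open scoped Real Chebyshev

namespace Literature.NumberTheory.LFunctions

namespace Zhao2025

open PsiTailIntegral NicolasJExplicit MertensFirstChain MertensFirstChainRun
open Literature.Analysis.SpecialFunctions

/-! ### §1 The constant `E = ℰ₁`: `−1.333 < E < −1.2336` -/

/-- The Rosser–Schoenfeld (3.22)-chain invariant after the first certified chunk (prime `224743`).
[cite: RosserSchoenfeld1962, Thm. 6 (3.22)] -/
theorem mertensChain_inv_run1 :
    Inv ⟨224743, 14897245679027811038026167, 14897245679028286644533155,
        13289279305559807331808632, 913176825354206810855071⟩ :=
  runDM_sound initM_inv run1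

/-- The chain invariant after the second certified chunk (prime `442439`, the first prime beyond `e¹³`).
[cite: RosserSchoenfeld1962, Thm. 6 (3.22)] -/
theorem mertensChain_inv_run2 :
    Inv ⟨442439, 15716105628607899312644944, 15716105628608374919620644,
        14107133587455640452304100, 913179468369670269995473⟩ :=
  runDM_sound mertensChain_inv_run1 run2

/-- **`−ELO/2⁸⁰ ≤ E`** (`ELO/2⁸⁰ = 1.3329…`, `E = −1.33258…`) from the final state of the certified run
(`rosserSchoenfeldE_ge_of_inv`: `γ`, the certified partial sum and the telescoped tail beyond `442439`).
[cite: RosserSchoenfeld1962, (2.11)] -/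
theorem rosserSchoenfeldE_ge_chain : -(ELO : ℝ) / 2 ^ 80 ≤ rosserSchoenfeldE :=
  rosserSchoenfeldE_ge_of_inv mertensChain_inv_run2 (by decide +kernel)

/-- **`E > −1.333`** (printed value `E = −1.33258 22757…`, RS62 (2.11); Zhao's `ℰ₁`).
[cite: Zhao2025MertensMean, §1.1 (value of ℰ₁)] -/
theorem rosserSchoenfeldE_gt : (-1.333 : ℝ) < rosserSchoenfeldE := by
  have h := rosserSchoenfeldE_ge_chain
  rw [ELO_real] at h
  have h2 : (-1.333 : ℝ) < -(1611377224964339226965862 : ℝ) / 2 ^ 80 := by norm_num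
  linarith

/-! ### §2 Kernel enclosures of small logarithms -/

/-- `1.0986122 < log 3 < 1.0986123` (`KernelLog.logIv 3`, evaluated by the kernel). [folklore] -/
private theorem log_three_bounds : (1.0986122 : ℝ) < Real.log 3 ∧ Real.log 3 < 1.0986123 := by
  have h := KernelLog.logIv_sound (n := 3) (lo := 1328140761516560292552947)
    (hi := 1328140761517035898327275) (by decide +kernel)
  have e3 : ((3 : ℕ) : ℝ) = 3 := by norm_num
  rw [e3] at h
  constructor
  · have : (1.0986122 : ℝ) < ((1328140761516560292552947 : ℤ) : ℝ) / 2 ^ 80 := by norm_num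
    linarith [h.1]
  · have : ((1328140761517035898327275 : ℤ) : ℝ) / 2 ^ 80 < 1.0986123 := by norm_num
    linarith [h.2]

/-- `1.6094379 < log 5 < 1.609438` (`KernelLog.logIv 5`). [folklore] -/
private theorem log_five_bounds : (1.6094379 : ℝ) < Real.log 5 ∧ Real.log 5 < 1.609438 := by
  have h := KernelLog.logIv_sound (n := 5) (lo := 1945691047408014769869345)
    (hi := 1945691047408490375643673) (by decide +kernel)
  have e5 : ((5 : ℕ) : ℝ) = 5 := by norm_num
  rw [e5] at h
  constructor
  · have : (1.6094379 : ℝ) < ((1945691047408014769869345 : ℤ) : ℝ) / 2 ^ 80 := by norm_num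
    linarith [h.1]
  · have : ((1945691047408490375643673 : ℤ) : ℝ) / 2 ^ 80 < 1.609438 := by norm_num
    linarith [h.2]

/-- `1.9459101 < log 7 < 1.9459102` (`KernelLog.logIv 7`). [folklore] -/
private theorem log_seven_bounds : (1.9459101 : ℝ) < Real.log 7 ∧ Real.log 7 < 1.9459102 := by
  have h := KernelLog.logIv_sound (n := 7) (lo := 2352461021842882059741018)
    (hi := 2352461021843357665563704) (by decide +kernel)
  have e7 : ((7 : ℕ) : ℝ) = 7 := by norm_num
  rw [e7] at h
  constructor
  · have : (1.9459101 : ℝ) < ((2352461021842882059741018 : ℤ) : ℝ) / 2 ^ 80 := by norm_num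
    linarith [h.1]
  · have : ((2352461021843357665563704 : ℤ) : ℝ) / 2 ^ 80 < 1.9459102 := by norm_num
    linarith [h.2]

/-- `2.3978952 < log 11 < 2.3978953` (`KernelLog.logIv 11`). [folklore] -/
private theorem log_eleven_bounds : (2.3978952 : ℝ) < Real.log 11 ∧ Real.log 11 < 2.3978953 := by
  have h := KernelLog.logIv_sound (n := 11) (lo := 2898877508017578593179883)
    (hi := 2898877508018054199050927) (by decide +kernel)
  have e11 : ((11 : ℕ) : ℝ) = 11 := by norm_num
  rw [e11] at h
  constructor
  · have : (2.3978952 : ℝ) < ((2898877508017578593179883 : ℤ) : ℝ) / 2 ^ 80 := by norm_num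
    linarith [h.1]
  · have : ((2898877508018054199050927 : ℤ) : ℝ) / 2 ^ 80 < 2.3978953 := by norm_num
    linarith [h.2]

/-- **`E < −1.2336`**: `−E = γ + Σ_p (log p)/(p(p−1)) ≥ γ + Σ_{p ≤ 7} (log p)/(p(p−1))`
(`MertensChain.neg_rosserSchoenfeldE_ge 7`) with `γ > 0.57721558` and the enclosures of §2.
[cite: Zhao2025MertensMean, §1.1 (value of ℰ₁)] -/
theorem rosserSchoenfeldE_lt : rosserSchoenfeldE < -1.2336 := by
  have h := MertensChain.neg_rosserSchoenfeldE_ge 7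
  have h7 : Nat.primesLE 7 = {2, 3, 5, 7} := by decide
  have hsum : ∑ q ∈ Nat.primesLE 7, Real.log q / ((q : ℝ) * ((q : ℝ) - 1)) =
      Real.log 2 / 2 + Real.log 3 / 6 + Real.log 5 / 20 + Real.log 7 / 42 := by
    rw [h7, Finset.sum_insert (by decide), Finset.sum_insert (by decide), Finset.sum_insert (by decide),
      Finset.sum_singleton]
    push_cast
    ring
  rw [hsum] at h
  have hγ := Real.eulerMascheroniConstant_gt_d8
  have h2 := Real.log_two_gt_d9
  have h3 := log_three_bounds.1
  have h5 := log_five_bounds.1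
  have h7' := log_seven_bounds.1
  linarith

/-! ### §3 The source's §2 argument with explicit constants -/

/-- **`ψ(t) − θ(t) ≥ √t/4` for `t ≥ 9`**: `ψ − θ ≥ ψ(√t) ≥ θ(√t)` (Mathlib) and the tree's effective
`θ(y) ≥ y/4` (`y ≥ 3`, `quarter_le_theta`). The source uses Rosser–Schoenfeld's `ψ − θ > 0.98√x` (`x ≥ 121`),
(2.2). [cite: Zhao2025MertensMean, §2 (2.2)] -/
theorem quarter_sqrt_le_psi_sub_theta {t : ℝ} (ht : 9 ≤ t) : Real.sqrt t / 4 ≤ ψ t - θ t := by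
  have ht0 : 0 ≤ t := by linarith
  set y : ℝ := Real.sqrt t with hy
  have hy3 : 3 ≤ y := by
    rw [hy, show (3 : ℝ) = Real.sqrt 9 by rw [show (9 : ℝ) = 3 ^ 2 by norm_num, Real.sqrt_sq (by norm_num)]]
    exact Real.sqrt_le_sqrt ht
  have hθ : y / 4 ≤ θ y := Literature.NumberTheory.Multiplicative.quarter_le_theta hy3
  have h4 := Chebyshev.psi_sub_theta_ge_psi_add_psi_add_psi ht0
  have hsq : t ^ (2 : ℝ)⁻¹ = y := by
    rw [hy, Real.sqrt_eq_rpow]; norm_num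
  rw [hsq] at h4
  have h5 := Chebyshev.theta_le_psi y
  have h6 : 0 ≤ ψ (t ^ (3 : ℝ)⁻¹) := Chebyshev.psi_nonneg _
  have h7 : 0 ≤ ψ (t ^ (7 : ℝ)⁻¹) := Chebyshev.psi_nonneg _
  linarith

/-- `∫_x^∞ (ψ − θ)/t² ≥ ∫_x^∞ t^{-3/2}/4 = x^{-1/2}/2` for `x ≥ 9` — the explicit version of the source's
`∫_X^∞ (ψ − θ)/x² > 1.96/√X`. [cite: Zhao2025MertensMean, §2 (display after (2.2))] -/
theorem half_rpow_neg_half_le_integral_psi_sub_theta {x : ℝ} (hx : 9 ≤ x) :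
    x ^ (-(1 / 2 : ℝ)) / 2 ≤ ∫ t in Ioi x, (ψ t - θ t) / t ^ 2 := by
  have hx0 : 0 < x := by linarith
  have hval : ∫ t in Ioi x, (1 / 4 : ℝ) * t ^ (-(3 / 2 : ℝ)) = x ^ (-(1 / 2 : ℝ)) / 2 := by
    rw [integral_const_mul, integral_Ioi_rpow_of_lt (by norm_num) hx0,
      show (-(3 / 2 : ℝ) + 1) = -(1 / 2) by norm_num]
    ring
  rw [← hval]
  refine setIntegral_mono_on ((integrableOn_Ioi_rpow_of_lt (by norm_num : (-(3 / 2 : ℝ)) < -1) hx0).const_mul _)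
    (RosserSchoenfeld.integrableOn_psi_sub_theta_div_sq.mono_set (Ioi_subset_Ioi (by linarith)))
    measurableSet_Ioi fun t ht => ?_
  have htx : x < t := ht
  have ht0 : 0 < t := hx0.trans htx
  have hrp : (1 / 4 : ℝ) * t ^ (-(3 / 2 : ℝ)) = (Real.sqrt t / 4) / t ^ 2 := by
    rw [Real.sqrt_eq_rpow, show (-(3 / 2 : ℝ)) = 1 / 2 - 2 by norm_num, Real.rpow_sub ht0, Real.rpow_two]
    ring
  rw [hrp]
  exact div_le_div_of_nonneg_right (quarter_sqrt_le_psi_sub_theta (hx.trans htx.le)) (by positivity)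

/-- **Under RH, `X ∫_X^∞ (θ(t) − t) t⁻² dt ≤ (β − 1/2)√X − log 2π + 1/(2(X² − 1))`** for `X ≥ 9` (the source's
`∫_X^∞ (θ − x)/x² < (B₁ − 1.96)/√X`, `X ≥ 10⁸`): split `θ − t = (ψ − t) − (ψ − θ)`, bound the first tail by
Rosser–Schoenfeld's Lemma 7 in exact form with `K(X) = β/√X` (`rsK_eq_of_RH`) and the second from below by
`1/(2√X)`. [cite: Zhao2025MertensMean, §2 (display after (2.2)), (2.3)] -/
theorem mul_tail_le_explicit_of_RH (hRH : RiemannHypothesis) {x : ℝ} (hx : 9 ≤ x) :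
    x * ∫ t in Ioi x, (θ t - t) / t ^ 2 ≤
      (nicolasBeta - 1 / 2) * Real.sqrt x - Real.log (2 * π) + 1 / (2 * (x ^ 2 - 1)) := by
  have hx1 : 1 < x := by linarith
  have hx0 : 0 < x := by linarith
  have hsplit : ∫ t in Ioi x, (θ t - t) / t ^ 2 =
      (∫ t in Ioi x, (ψ t - t) / t ^ 2) - ∫ t in Ioi x, (ψ t - θ t) / t ^ 2 := by
    rw [← integral_sub (RosserSchoenfeld.integrableOn_psi_sub_self_div_sq.mono_set (Ioi_subset_Ioi hx1.le))
      (RosserSchoenfeld.integrableOn_psi_sub_theta_div_sq.mono_set (Ioi_subset_Ioi hx1.le))]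
    refine setIntegral_congr_fun measurableSet_Ioi fun t _ => ?_
    ring
  have h1 := integral_Ioi_psi_sub_self_div_sq_le hx1
  rw [rsK_eq_of_RH hRH hx0] at h1
  have h2 := half_rpow_neg_half_le_integral_psi_sub_theta hx
  have hsqrt : x * x ^ (-(1 / 2 : ℝ)) = Real.sqrt x := by
    have e : x ^ (1 / 2 : ℝ) = x ^ ((1 : ℝ) + -(1 / 2)) := by norm_num
    rw [Real.sqrt_eq_rpow, e, Real.rpow_add hx0, Real.rpow_one]
  have hx21 : 0 < x ^ 2 - 1 := by nlinarith
  rw [hsplit]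
  calc x * ((∫ t in Ioi x, (ψ t - t) / t ^ 2) - ∫ t in Ioi x, (ψ t - θ t) / t ^ 2)
      ≤ x * (x ^ (-(1 / 2 : ℝ)) * nicolasBeta - Real.log (2 * π) / x + 1 / (2 * x * (x ^ 2 - 1)) -
          x ^ (-(1 / 2 : ℝ)) / 2) := by
        refine mul_le_mul_of_nonneg_left ?_ hx0.le
        linarith
    _ = (nicolasBeta - 1 / 2) * (x * x ^ (-(1 / 2 : ℝ))) - Real.log (2 * π) + 1 / (2 * (x ^ 2 - 1)) := by
        field_simp
        ring
    _ = (nicolasBeta - 1 / 2) * Real.sqrt x - Real.log (2 * π) + 1 / (2 * (x ^ 2 - 1)) := by rw [hsqrt]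

/-- **Explicit lower bound under RH**: for `X ≥ 9`,
`∫₂^X E₁ ≥ 2 log 2 − 2 + 2E + log 2π − 1/(2(X² − 1)) + (1/2 − β)√X` ((2.1) with the printed constant,
`integral_E₁_eq'`, and `mul_tail_le_explicit_of_RH`). [cite: Zhao2025MertensMean, §2 ((2.1)–(2.3))] -/
theorem integral_E₁_ge_explicit_of_RH (hRH : RiemannHypothesis) {X : ℝ} (hX : 9 ≤ X) :
    2 * Real.log 2 - 2 + 2 * rosserSchoenfeldE + Real.log (2 * π) - 1 / (2 * (X ^ 2 - 1)) +
        (1 / 2 - nicolasBeta) * Real.sqrt X ≤ ∫ x in (2 : ℝ)..X, E₁ x := by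
  rw [integral_E₁_eq' (by linarith : (2 : ℝ) ≤ X)]
  have h := mul_tail_le_explicit_of_RH hRH hX
  linarith

/-- **Under RH, `∫₂^X E₁(x) dx > 0` for every `X ≥ 11`** (numerics: `log 2 > 0.6931471803`,
`log π > 1.1447298858`, `E > −1.333`, `β < 0.0474`, `√11 > 3.3166`; the margin at `X = 11` is `0.055`).
[cite: Zhao2025MertensMean, Thm 1 (i = 1), (a) ⟹ (b); §2] -/
theorem integral_E₁_pos_of_RH_of_eleven_le (hRH : RiemannHypothesis) {X : ℝ} (hX : 11 ≤ X) :
    0 < ∫ x in (2 : ℝ)..X, E₁ x := by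
  have h := integral_E₁_ge_explicit_of_RH hRH (by linarith : (9 : ℝ) ≤ X)
  have hE := rosserSchoenfeldE_gt
  have hβ := nicolasBeta_lt'
  have hl2 := Real.log_two_gt_d9
  have hlπ := Real.log_pi_gt_d20
  have hlog2π : Real.log (2 * π) = Real.log 2 + Real.log π :=
    Real.log_mul (by norm_num) Real.pi_pos.ne'
  have hsqrt : (3.3166 : ℝ) ≤ Real.sqrt X := by
    have : (3.3166 : ℝ) ≤ Real.sqrt 11 := by
      rw [Real.le_sqrt (by norm_num) (by norm_num)]
      norm_num
    exact this.trans (Real.sqrt_le_sqrt hX)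
  have hfrac : 1 / (2 * (X ^ 2 - 1)) ≤ 1 / 240 := by
    apply div_le_div_of_nonneg_left (by norm_num) (by norm_num)
    nlinarith
  have hprod : (0.4526 : ℝ) * 3.3166 ≤ (1 / 2 - nicolasBeta) * Real.sqrt X :=
    mul_le_mul (by linarith) hsqrt (by norm_num) (by linarith)
  rw [hlog2π] at h
  linarith

/-! ### §4 The finite range `2 ≤ x < 11`, without RH -/

/-- `S(3) = (log 2)/2 + (log 3)/3` (`S(x) = Σ_{p ≤ x} (log p)/p = Mertens.primeLogDivSum`). [folklore] -/
private theorem primeLogDivSum_three : Mertens.primeLogDivSum 3 = Real.log 2 / 2 + Real.log 3 / 3 := by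
  have h := MertensChain.sum_primesLE_succ_prime (fun q : ℕ => Real.log q / q) Nat.prime_three
    (by norm_num : 2 < 3) (fun q h1 h2 => by omega)
  have h3 : Mertens.primeLogDivSum ((3 : ℕ) : ℝ) = _ := MertensChain.primeLogDivSum_natCast 3
  rw [Nat.cast_ofNat] at h3
  rw [h3, h, ← MertensChain.primeLogDivSum_natCast 2, Nat.cast_ofNat, MertensChain.primeLogDivSum_two]
  push_cast
  ring

/-- `S(5) = S(3) + (log 5)/5`. [folklore] -/
private theorem primeLogDivSum_five :
    Mertens.primeLogDivSum 5 = Real.log 2 / 2 + Real.log 3 / 3 + Real.log 5 / 5 := by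
  have h := MertensChain.sum_primesLE_succ_prime (fun q : ℕ => Real.log q / q) Nat.prime_five
    (by norm_num : 3 < 5) (fun q h1 h2 => by interval_cases q; decide)
  have h5 : Mertens.primeLogDivSum ((5 : ℕ) : ℝ) = _ := MertensChain.primeLogDivSum_natCast 5
  rw [Nat.cast_ofNat] at h5
  rw [h5, h, ← MertensChain.primeLogDivSum_natCast 3, Nat.cast_ofNat, primeLogDivSum_three]
  push_cast
  ring

/-- `S(7) = S(5) + (log 7)/7`. [folklore] -/
private theorem primeLogDivSum_seven :
    Mertens.primeLogDivSum 7 = Real.log 2 / 2 + Real.log 3 / 3 + Real.log 5 / 5 + Real.log 7 / 7 := by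
  have h7p : Nat.Prime 7 := by norm_num
  have h := MertensChain.sum_primesLE_succ_prime (fun q : ℕ => Real.log q / q) h7p
    (by norm_num : 5 < 7) (fun q h1 h2 => by interval_cases q; decide)
  have h7 : Mertens.primeLogDivSum ((7 : ℕ) : ℝ) = _ := MertensChain.primeLogDivSum_natCast 7
  rw [Nat.cast_ofNat] at h7
  rw [h7, h, ← MertensChain.primeLogDivSum_natCast 5, Nat.cast_ofNat, primeLogDivSum_five]
  push_cast
  ring

/-- **`E₁(x) > 0` for `2 ≤ x < 11`, unconditionally** (the source quotes Rosser–Schoenfeld's «`E₁(x) > 0` for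
`2 ≤ x ≤ 10⁸`»; the kernel needs only `x < 11`): on each prime gap `[p, p′) ⊂ [2, 11)`,
`E₁(x) = S(p) − log x − E > S(p) − log p′ + 1.2336 ≥ −1.0853 + 1.2336 > 0`.
[cite: Zhao2025MertensMean, §1.1 and §2 («E_i(x) > 0 for 2 ≤ x ≤ 10⁸» [RS])] -/
theorem E₁_pos_of_lt_eleven {x : ℝ} (h2 : 2 ≤ x) (h11 : x < 11) : 0 < E₁ x := by
  have hE := rosserSchoenfeldE_lt
  have hl2 := Real.log_two_gt_d9
  have hl3 := log_three_bounds
  have hl5 := log_five_bounds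
  have hl7 := log_seven_bounds
  have hl11 := log_eleven_bounds
  have hx0 : 0 < x := by linarith
  unfold E₁
  rcases lt_or_ge x 3 with hx3 | hx3
  · -- `[2, 3)`: `S(x) = S(2) = (log 2)/2`, `log x < log 3`
    have hS : Mertens.primeLogDivSum x = Mertens.primeLogDivSum 2 := by
      have := MertensChain.primeLogDivSum_real_eq (p := 2) (p' := 3) (fun q h1 h2 => by omega)
        (by exact_mod_cast h2) (by exact_mod_cast hx3)
      simpa using this
    rw [hS, MertensChain.primeLogDivSum_two]
    have hlog : Real.log x < Real.log 3 := Real.log_lt_log hx0 hx3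
    linarith
  rcases lt_or_ge x 5 with hx5 | hx5
  · -- `[3, 5)`
    have hS : Mertens.primeLogDivSum x = Mertens.primeLogDivSum 3 := by
      have := MertensChain.primeLogDivSum_real_eq (p := 3) (p' := 5)
        (fun q h1 h2 => by interval_cases q; decide) (by exact_mod_cast hx3) (by exact_mod_cast hx5)
      simpa using this
    rw [hS, primeLogDivSum_three]
    have hlog : Real.log x < Real.log 5 := Real.log_lt_log hx0 hx5
    linarith
  rcases lt_or_ge x 7 with hx7 | hx7
  · -- `[5, 7)`
    have hS : Mertens.primeLogDivSum x = Mertens.primeLogDivSum 5 := by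
      have := MertensChain.primeLogDivSum_real_eq (p := 5) (p' := 7)
        (fun q h1 h2 => by interval_cases q; decide) (by exact_mod_cast hx5) (by exact_mod_cast hx7)
      simpa using this
    rw [hS, primeLogDivSum_five]
    have hlog : Real.log x < Real.log 7 := Real.log_lt_log hx0 hx7
    linarith
  · -- `[7, 11)`
    have hS : Mertens.primeLogDivSum x = Mertens.primeLogDivSum 7 := by
      have := MertensChain.primeLogDivSum_real_eq (p := 7) (p' := 11)
        (fun q h1 h2 => by interval_cases q <;> decide) (by exact_mod_cast hx7) (by exact_mod_cast h11)
      simpa using this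
    rw [hS, primeLogDivSum_seven]
    have hlog : Real.log x < Real.log 11 := Real.log_lt_log hx0 h11
    linarith

/-- **`∫₂^X E₁(x) dx > 0` for `2 < X ≤ 11`, unconditionally** (the integrand is positive on `(2, X)`).
[cite: Zhao2025MertensMean, §2 (first sentence: the range below the crossover)] -/
theorem integral_E₁_pos_of_le_eleven {X : ℝ} (h2 : 2 < X) (h11 : X ≤ 11) :
    0 < ∫ x in (2 : ℝ)..X, E₁ x :=
  intervalIntegral.intervalIntegral_pos_of_pos_on (intervalIntegrable_E₁ le_rfl h2.le)
    (fun _ hx => E₁_pos_of_lt_eleven hx.1.le (lt_of_lt_of_le hx.2 h11)) h2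

/-! ### §5 Theorem 1, clause `i = 1`, as printed -/

/-- **Zhao 2025, Theorem 1 (`i = 1`), (a) ⟹ (b) AS PRINTED, PROVED**: under RH, `∫₂^X E₁(x) dx > 0` for EVERY
`X > 2` (`X ≥ 11`: the explicit §2 argument; `2 < X ≤ 11`: `E₁ > 0` pointwise, no RH needed).
[cite: Zhao2025MertensMean, Thm 1 (i = 1), (a) ⟹ (b); §2] -/
theorem integral_E₁_pos_of_RH (hRH : RiemannHypothesis) {X : ℝ} (hX : 2 < X) :
    0 < ∫ x in (2 : ℝ)..X, E₁ x := by
  rcases le_or_gt X 11 with h11 | h11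
  · exact integral_E₁_pos_of_le_eleven hX h11
  · exact integral_E₁_pos_of_RH_of_eleven_le hRH h11.le

end Zhao2025

/-- **Zhao 2025, Theorem 1, clause `i = 1`, AS PRINTED, PROVED**: `RH ⟺ ∫₂^X E₁(x) dx > 0` for all `X > 2`
(`⟹`: `Zhao2025.integral_E₁_pos_of_RH`; `⟸`: `Zhao2025.riemannHypothesis_of_integral_E₁_pos`, Landau's theorem).
This is the first conjunct of the named fact `Zhao2025MertensMean_thm1` (`Zhao2025MertensMean_thm1_clause1_eq`); the
second conjunct (`i = 2`) is proved in the tree only in the «sufficiently large `X`» reading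
(`Zhao2025.riemannHypothesis_iff_eventually_integral_E₂_pos`). An RH-EQUIVALENCE; nothing here bears on the truth of
RH. [cite: Zhao2025MertensMean, Thm 1 (i = 1)] -/
theorem Zhao2025MertensMean_thm1_clause1 :
    RiemannHypothesis ↔ ∀ X : ℝ, 2 < X → 0 < ∫ x in (2 : ℝ)..X, Zhao2025.E₁ x :=
  ⟨fun hRH _ hX => Zhao2025.integral_E₁_pos_of_RH hRH hX, Zhao2025.riemannHypothesis_of_integral_E₁_pos⟩

/-- The named fact `Zhao2025MertensMean_thm1` is, verbatim, `Zhao2025MertensMean_thm1_clause1`'s statement `∧` the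
`i = 2` clause; so the fact now reduces to its second conjunct. [cite: Zhao2025MertensMean, Thm 1] -/
theorem Zhao2025MertensMean_thm1_clause1_eq :
    Zhao2025MertensMean_thm1 ↔
      (RiemannHypothesis ↔ ∀ X : ℝ, 2 < X → 0 < ∫ x in (2 : ℝ)..X, Zhao2025.E₂ x) := by
  unfold Zhao2025MertensMean_thm1
  exact ⟨fun h => h.2, fun h => ⟨Zhao2025MertensMean_thm1_clause1, h⟩⟩

end Literature.NumberTheory.LFunctions

end
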